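import Literature.AlgebraicGeometry.HodgeTheory.HomComplexRow
import Literature.AlgebraicGeometry.Modules.SheafHomTranspose
import HarnessLib

/-!
# The transpose chain isomorphism `𝓗om•(E•, F•) ≅ 𝓗om•(F•^∨, E•^∨)` for complexes of vector bundles

Layer `Literature/AlgebraicGeometry/HodgeTheory`; sequel to `HomComplex.lean` (the internal Hom complex `homComplex X E F = 𝓗om•(E•, F•)`,
summands `ι`, differentials `ι_D₁`/`ι_D₂` with Mathlib's `HomComplex` sign `ψ ↦ ψ ≫ d_F + (-1)^{n+1} d_E ≫ ψ`), `HomComplexRow.lean`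
(the `𝒪`-valued dual complex `dualVB X F := rowComplex X F 𝒪_X`: terms `(F^{-m})^∨`, differential `(-1)^{m+1} (d_F)^∨`; `≅ 𝓗om•(F•, 𝒪_X[0])`)
and `Modules/SheafHomTranspose.lean` (the internal transpose `transposeDual A B : 𝓗om(A, B) ⟶ 𝓗om(B^∨, A^∨)`, an ISOMORPHISM for
`A`, `B` finite locally free — Hartshorne II Ex. 5.1). For a scheme `X` and cochain complexes `E•`, `F•` of `𝒪_X`-modules:

* `transposeDual_naturality_right/left` — the transpose is natural in both variables: `(ψ ≫ g)^∨ = g^∨ ≫ ψ^∨`, `(h ≫ ψ)^∨ = ψ^∨ ≫ h^∨`;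
* `HomComplex.transposeSummand` — on the summand `𝓗om(E^{-i}, F^q)` of `𝓗om•(E•, F•)^n`: `ψ ↦ (-1)^{q(i+1)} • ψ^∨` placed on the summand
  `𝓗om((F^q)^∨, (E^{-i})^∨) = 𝓗om((F•^∨)^{-q}, (E•^∨)^{i})` of `𝓗om•(F•^∨, E•^∨)^n` (index flip `(q, i) ↦ (i, q)`; the re-indexing `F^q = F^{-(-q)}`
  is an `XIsoOfEq`); `HomComplex.transposeHom : 𝓗om•(E•, F•) ⟶ 𝓗om•(F•^∨, E•^∨)` — A CHAIN MAP: with these signs the `F`-differential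
  (no sign) goes to the `E•^∨`-source differential of `𝓗om•(F•^∨, E•^∨)` and the signed `E`-differential to its target differential
  (`ι_transposeF_comm`; the sign `(-1)^{q(i+1)}` is forced by the three conventions above);
* **`HomComplex.transposeIso X E F hE hF : homComplex X E F ≅ homComplex X (dualVB X F) (dualVB X E)`** for `E•`, `F•` with finite locally free
  terms (degreewise inverse from `isIso_transposeDual`).

Everything is a construction or a proved lemma; no named facts. Motivation: brick B (the «transpose chain iso» of ROAD K) of the
derived-duality item (β3) of the Hodge programme's road №4 (crux 26512); nothing of that crux is asserted here. The final form
`𝓗om•(𝓗om•(F•, 𝒪[0]), 𝓗om•(E•, 𝒪[0])) ≅ 𝓗om•(E•, F•)` (conjugating by the row isomorphisms) is the sequel `HomComplexDualTranspose.lean`.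

## References

* R. Hartshorne, *Algebraic Geometry* (1977), II Ex. 5.1 (a), (b) (`𝓗om(A, B) ≅ 𝓗om(B^∨, A^∨)` for locally free sheaves). [Hartshorne1977]
* The Stacks project, *More on Algebra*, Section «Hom complexes» (signs). [StacksProject]
* C. A. Weibel, *An introduction to homological algebra* (1994), 2.7.4–2.7.5. [Weibel1994]
-/

noncomputable section

open CategoryTheory CategoryTheory.Limits AlgebraicGeometry Opposite

universe u

namespace Literature.AlgebraicGeometry.HodgeTheory

open Literature.AlgebraicGeometry.Modules Literature.AlgebraicGeometry.Motives

/-! ## §1 Naturality of the internal transpose in both variables -/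

section TransposeNaturality

variable {X : Scheme.{u}}

/-- **`(ψ ≫ g)^∨ = g^∨ ≫ ψ^∨`**: the transpose `𝓗om(A, –) ⟶ 𝓗om((–)^∨, A^∨)` is natural in the second variable —
`𝓗om(A, g) ≫ T_{A,B'} = T_{A,B} ≫ 𝓗om(g^∨, A^∨)` (sections: `precompOver_comp`, `precompOver_over_map`). [cite: Hartshorne1977, II Ex. 5.1]
[cite: StacksProject, Tag 01CM (functoriality of the internal Hom)] -/
theorem transposeDual_naturality_right (A : X.Modules) {B B' : X.Modules} (g : B ⟶ B') :
    sheafHomMap A g ≫ transposeDual A B' = transposeDual A B ≫ sheafHomMapLeft (sheafHomMapLeft g (unitModule X)) (dual A) := by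
  refine Scheme.Modules.hom_ext _ _ fun U => AddCommGrpCat.ext fun (ψ : A.over U ⟶ B.over U) => ?_
  change (transposeDual A B').app U ((sheafHomMap A g).app U ψ) =
    (sheafHomMapLeft (sheafHomMapLeft g (unitModule X)) (dual A)).app U ((transposeDual A B).app U ψ)
  rw [sheafHomMap_app_apply, transposeHom_app_apply, transposeHom_app_apply, sheafHomMapLeft_app_apply, precompOver_comp,
    precompOver_over_map]

/-- **`(h ≫ ψ)^∨ = ψ^∨ ≫ h^∨`**: the transpose is natural in the first variable —
`𝓗om(h, B) ≫ T_{A',B} = T_{A,B} ≫ 𝓗om(B^∨, h^∨)`. [cite: Hartshorne1977, II Ex. 5.1] [cite: StacksProject, Tag 01CM (functoriality of the internal Hom)] -/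
theorem transposeDual_naturality_left {A A' : X.Modules} (h : A' ⟶ A) (B : X.Modules) :
    sheafHomMapLeft h B ≫ transposeDual A' B = transposeDual A B ≫ sheafHomMap (dual B) (sheafHomMapLeft h (unitModule X)) := by
  refine Scheme.Modules.hom_ext _ _ fun U => AddCommGrpCat.ext fun (ψ : A.over U ⟶ B.over U) => ?_
  change (transposeDual A' B).app U ((sheafHomMapLeft h B).app U ψ) =
    (sheafHomMap (dual B) (sheafHomMapLeft h (unitModule X))).app U ((transposeDual A B).app U ψ)
  rw [sheafHomMapLeft_app_apply, transposeHom_app_apply, transposeHom_app_apply, sheafHomMap_app_apply, precompOver_comp,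
    precompOver_over_map]

end TransposeNaturality

namespace HomComplex

variable (X : Scheme.{u}) (E F : CochainComplex X.Modules ℤ)

/-! ## §2 The `𝒪`-dual complex and the summand maps -/

/-- **The dual complex of vector-bundle type** `F•^∨`: `m ↦ (F^{-m})^∨`, differential `(-1)^{m+1} • (d_F)^∨` (the `𝒪_X`-valued row complex of
`HomComplexRow.lean`; `≅ 𝓗om•(F•, 𝒪_X[0])` by `rowIso`). [cite: Weibel1994, 2.7.4–2.7.5 (Hom cochain complex)] -/
abbrev dualVB : CochainComplex X.Modules ℤ := rowComplex X F (unitModule X)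

/-- The sign `(-1)^{q(i+1)}` on the summand `𝓗om(E^{-i}, F^q)` of the transpose chain map. [folklore] -/
def trSign (q i : ℤ) : ℤˣ := (q * (i + 1)).negOnePow

/-- `trSign (q+1) i = (-1)^{i+1} trSign q i`. [folklore] -/
private lemma trSign_succ_left (q i : ℤ) : trSign (q + 1) i = (i + 1).negOnePow * trSign q i := by
  unfold trSign
  rw [add_mul, one_mul, Int.negOnePow_add, mul_comm]

/-- `trSign q (i+1) = (-1)^{q} trSign q i`. [folklore] -/
private lemma trSign_succ_right (q i : ℤ) : trSign q (i + 1) = q.negOnePow * trSign q i := by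
  unfold trSign
  rw [show q * (i + 1 + 1) = q * (i + 1) + q by ring, Int.negOnePow_add, mul_comm]

/-- `𝓗om(A, –)` commutes with the unit-signs `(-1)^k • –` (additivity). [folklore] -/
private lemma sheafHomMap_units_smul {A M N : X.Modules} (u : ℤˣ) (f : M ⟶ N) : sheafHomMap A (u • f) = u • sheafHomMap A f := by
  rw [Units.smul_def, Units.smul_def]
  exact (sheafHomFunctor A).map_zsmul

variable {X E F} in
/-- The transpose `𝓗om(E^{-i}, F^{-(-q)}) ⟶ 𝓗om((F•^∨)^{-q}, (E•^∨)^{i})`, with its target SPELLED as the `(i, q)`-summand object of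
`𝓗om•(F•^∨, E•^∨)` (definitionally `𝓗om((F^{-(-q)})^∨, (E^{-i})^∨)`). [cite: Hartshorne1977, II Ex. 5.1 (b)] -/
abbrev τ (i q : ℤ) : sheafHom (E.X (-i)) (F.X (-(-q))) ⟶ sheafHom ((dualVB X F).X (-q)) ((dualVB X E).X i) :=
  transposeDual (E.X (-i)) (F.X (-(-q)))

variable {X E F} in
/-- The re-indexing `𝓗om(E^{-i}, F^q) ⟶ 𝓗om(E^{-i}, F^{-(-q)})` (`F.XIsoOfEq`). [folklore] -/
abbrev κ (i q : ℤ) : sheafHom (E.X (-i)) (F.X q) ⟶ sheafHom (E.X (-i)) (F.X (-(-q))) :=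
  sheafHomMap (E.X (-i)) (F.XIsoOfEq (neg_neg q)).inv

variable {X E F} in
/-- **The transpose on a summand**: `𝓗om(E^{-i}, F^q) ⟶ 𝓗om•(F•^∨, E•^∨)^n` (`q + i = n`), `ψ ↦ (-1)^{q(i+1)} • ψ^∨` on the summand
`(i, q)` of the target (object `𝓗om((F^{-(-q)})^∨, (E^{-i})^∨)`; the re-indexing `F^q ≅ F^{-(-q)}` is `κ`).
[cite: Hartshorne1977, II Ex. 5.1 (b)] [cite: StacksProject, More on Algebra, Section «Hom complexes»] -/
def transposeSummand (q i n : ℤ) (h : q + i = n) :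
    sheafHom (E.X (-i)) (F.X q) ⟶ (homComplex X (dualVB X F) (dualVB X E)).X n :=
  (trSign q i : ℤˣ) • (κ i q ≫ τ i q ≫ ι X (dualVB X F) (dualVB X E) i q n (by lia))

/-- **The transpose in degree `n`**: `𝓗om•(E•, F•)^n ⟶ 𝓗om•(F•^∨, E•^∨)^n`, summand by summand `transposeSummand`.
[cite: Hartshorne1977, II Ex. 5.1 (b)] -/
def transposeF (n : ℤ) : (homComplex X E F).X n ⟶ (homComplex X (dualVB X F) (dualVB X E)).X n :=
  HomologicalComplex.mapBifunctorDesc fun q i hqi => transposeSummand q i n (by simp at hqi; lia)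

/-- `transposeF` on a summand. [cite: Hartshorne1977, II Ex. 5.1 (b)] -/
lemma ι_transposeF (q i n : ℤ) (h : q + i = n) : ι X E F q i n h ≫ transposeF X E F n = transposeSummand q i n h :=
  HomologicalComplex.ι_mapBifunctorDesc _ q i _

/-! ## §3 The commutations behind the chain-map property -/

variable {X E F} in
/-- The unsigned `E•^∨`-differential `(d_E^{-(i+1),-i})^∨ : (E^{-i})^∨ ⟶ (E^{-(i+1)})^∨`, spelled on the terms of `E•^∨`. [folklore] -/
abbrev δE (i : ℤ) : (dualVB X E).X i ⟶ (dualVB X E).X (i + 1) := sheafHomMapLeft (E.d (-(i + 1)) (-i)) (unitModule X)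

variable {X E F} in
/-- The unsigned `F•^∨`-differential `(d_F^{-(-q),-(-(q+1))})^∨ : (F•^∨)^{-(q+1)} ⟶ (F•^∨)^{-q}`, spelled on the terms of `F•^∨`. [folklore] -/
abbrev δF (q : ℤ) : (dualVB X F).X (-(q + 1)) ⟶ (dualVB X F).X (-q) := sheafHomMapLeft (F.d (-(-q)) (-(-(q + 1)))) (unitModule X)

/-- `d_{E•^∨}^{i,i+1} = (-1)^{i+1} • (d_E)^∨`. [cite: Weibel1994, 2.7.4–2.7.5 (Hom cochain complex)] -/
lemma dualVB_d_E (i : ℤ) : (dualVB X E).d i (i + 1) = ((i + 1).negOnePow : ℤˣ) • δE (X := X) (E := E) i :=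
  sheafHomMapLeft_units_smul _ _ _ _

/-- `d_{F•^∨}^{-(q+1),-q} = (-1)^{-q} • (d_F)^∨`. [cite: Weibel1994, 2.7.4–2.7.5 (Hom cochain complex)] -/
lemma dualVB_d_F (q : ℤ) : (dualVB X F).d (-(q + 1)) (-q) = ((-q).negOnePow : ℤˣ) • δF (X := X) (F := F) q :=
  sheafHomMapLeft_units_smul _ _ _ _

/-- **`E`-direction through the transpose**: `(d_E ≫ ψ)^∨ = ψ^∨ ≫ (d_E)^∨`, i.e. `𝓗om(d_E, F^{-(-q)}) ≫ τ = τ ≫ 𝓗om((F•^∨)^{-q}, (d_E)^∨)`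
(`transposeDual_naturality_left`). [cite: Hartshorne1977, II Ex. 5.1] -/
lemma mapLeft_d_comp_τ (i q : ℤ) :
    sheafHomMapLeft (E.d (-(i + 1)) (-i)) (F.X (-(-q))) ≫ τ (E := E) (F := F) (i + 1) q =
      τ i q ≫ sheafHomMap ((dualVB X F).X (-q)) (δE i) :=
  transposeDual_naturality_left _ _

/-- **`F`-direction through the transpose**: `(ψ ≫ d_F)^∨ = (d_F)^∨ ≫ ψ^∨`, i.e. `𝓗om(E^{-i}, d_F) ≫ τ = τ ≫ 𝓗om((d_F)^∨, (E^{-i})^∨)`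
(`transposeDual_naturality_right`). [cite: Hartshorne1977, II Ex. 5.1] -/
lemma map_d_comp_τ (i q : ℤ) :
    sheafHomMap (E.X (-i)) (F.d (-(-q)) (-(-(q + 1)))) ≫ τ (E := E) (F := F) i (q + 1) =
      τ i q ≫ sheafHomMapLeft (δF q) ((dualVB X E).X i) :=
  transposeDual_naturality_right _ _

/-- The re-indexing commutes with `𝓗om(d_E, –)`. [folklore] -/
private lemma mapLeft_comp_κ (i q : ℤ) :
    sheafHomMapLeft (E.d (-(i + 1)) (-i)) (F.X q) ≫ κ (E := E) (F := F) (i + 1) q =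
      κ i q ≫ sheafHomMapLeft (E.d (-(i + 1)) (-i)) (F.X (-(-q))) :=
  sheafHomMapLeft_sheafHomMap _ _ _

/-- The re-indexing commutes with `𝓗om(–, d_F)`: `𝓗om(E^{-i}, d_F^{q,q+1}) ≫ κ_{q+1} = κ_q ≫ 𝓗om(E^{-i}, d_F^{-(-q),-(-(q+1))})`. [folklore] -/
private lemma map_d_comp_κ (i q : ℤ) :
    sheafHomMap (E.X (-i)) (F.d q (q + 1)) ≫ κ (E := E) (F := F) i (q + 1) = κ i q ≫ sheafHomMap (E.X (-i)) (F.d (-(-q)) (-(-(q + 1)))) := by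
  rw [← sheafHomMap_comp, ← sheafHomMap_comp, HomologicalComplex.d_comp_XIsoOfEq_inv, HomologicalComplex.XIsoOfEq_inv_comp_d]

/-- `κ` followed by the inverse re-indexing is the identity. [folklore] -/
private lemma κ_comp_map_hom (i q : ℤ) : κ (E := E) (F := F) i q ≫ sheafHomMap (E.X (-i)) (F.XIsoOfEq (neg_neg q)).hom = 𝟙 _ := by
  rw [← sheafHomMap_comp, Iso.inv_hom_id, sheafHomMap_id]

/-- The inverse re-indexing followed by `κ` is the identity. [folklore] -/
private lemma map_hom_comp_κ (i q : ℤ) : sheafHomMap (E.X (-i)) (F.XIsoOfEq (neg_neg q)).hom ≫ κ (E := E) (F := F) i q = 𝟙 _ := by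
  rw [← sheafHomMap_comp, Iso.hom_inv_id, sheafHomMap_id]

/-- The sign identity on the `E`-direction summand: `(-1)^{q(i+1)} (-1)^{i+1} = (-1)^{n+1} (-1)^{q(i+2)}` (`n = q + i`). [folklore] -/
private lemma trSign_rel_E (q i n : ℤ) (h : q + i = n) :
    trSign q i * (i + 1).negOnePow = (n + 1).negOnePow * trSign q (i + 1) := by
  subst h
  simp only [trSign, ← Int.negOnePow_add, Int.negOnePow_eq_iff]
  exact ⟨-q, by ring⟩

/-- The sign identity on the `F`-direction summand: `(-1)^{q(i+1)} (-1)^{n+1} (-1)^{-q} = (-1)^{(q+1)(i+1)}` (`n = q + i`). [folklore] -/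
private lemma trSign_rel_F (q i n : ℤ) (h : q + i = n) :
    trSign q i * ((n + 1).negOnePow * (-q).negOnePow) = trSign (q + 1) i := by
  subst h
  simp only [trSign, ← Int.negOnePow_add, Int.negOnePow_eq_iff]
  exact ⟨0, by ring⟩

/-- **THE TRANSPOSE IS A CHAIN MAP, summand by summand**: on `𝓗om(E^{-i}, F^q)` (`q + i = n`),
`T_n ≫ d_{𝓗om•(F•^∨, E•^∨)} = d_{𝓗om•(E•, F•)} ≫ T_{n+1}` — the un-signed `F`-differential `ψ ↦ ψ ≫ d_F` goes to the (signed) source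
differential of `𝓗om•(F•^∨, E•^∨)` in the `F•^∨`-variable, the signed `E`-differential `(-1)^{n+1} d_E ≫ ψ` to its target differential, and the
signs `(-1)^{q(i+1)}` absorb the discrepancies (`trSign_rel_E`, `trSign_rel_F`). [cite: StacksProject, More on Algebra, Section «Hom complexes»]
[cite: Hartshorne1977, II Ex. 5.1 (b)] -/
theorem ι_transposeF_comm (q i n : ℤ) (h : q + i = n) :
    ι X E F q i n h ≫ transposeF X E F n ≫ (homComplex X (dualVB X F) (dualVB X E)).d n (n + 1) =
      ι X E F q i n h ≫ (homComplex X E F).d n (n + 1) ≫ transposeF X E F (n + 1) := by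
  rw [reassoc_of% (ι_transposeF X E F q i n h), HomologicalComplex.mapBifunctor.d_eq, HomologicalComplex.mapBifunctor.d_eq,
    Preadditive.comp_add, Preadditive.add_comp, Preadditive.comp_add]
  rw [transposeSummand, Linear.units_smul_comp, Linear.units_smul_comp]
  simp only [Category.assoc]
  rw [ι_D₁ X (dualVB X F) (dualVB X E) i q n (n + 1) (by lia) (by lia),
    ι_D₂ X (dualVB X F) (dualVB X E) i q n (n + 1) (by lia) (by lia),
    reassoc_of% (ι_D₁ X E F q i n (n + 1) h (by lia)), reassoc_of% (ι_D₂ X E F q i n (n + 1) h (by lia)),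
    ι_transposeF, Linear.units_smul_comp, Category.assoc, ι_transposeF]
  rw [dualVB_d_E X E, sheafHomMap_units_smul, dualVB_d_F X F, sheafHomMapLeft_units_smul]
  simp only [Linear.units_smul_comp, Linear.comp_units_smul, smul_smul]
  rw [← reassoc_of% (mapLeft_d_comp_τ X E F i q), ← reassoc_of% (mapLeft_comp_κ X E F i q),
    ← reassoc_of% (map_d_comp_τ X E F i q), ← reassoc_of% (map_d_comp_κ X E F i q), transposeSummand, transposeSummand]
  simp only [Linear.comp_units_smul, smul_smul]
  rw [trSign_rel_E q i n h, trSign_rel_F q i n h]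
  exact add_comm _ _

/-- **The transpose chain map `𝓗om•(E•, F•) ⟶ 𝓗om•(F•^∨, E•^∨)`**, `ψ ↦ (-1)^{q(i+1)} ψ^∨` on `𝓗om(E^{-i}, F^q)` (any complexes `E•`, `F•`;
an isomorphism for vector-bundle terms, `transposeIso`). [cite: Hartshorne1977, II Ex. 5.1 (b)] [cite: StacksProject, More on Algebra, Section «Hom complexes»] -/
def transposeHom : homComplex X E F ⟶ homComplex X (dualVB X F) (dualVB X E) where
  f n := transposeF X E F n
  comm' n n' hnn' := by
    obtain rfl : n + 1 = n' := hnn'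
    refine HomologicalComplex.mapBifunctor.hom_ext fun q i hqi => ?_
    exact ι_transposeF_comm X E F q i n (by simp at hqi; lia)

/-- Components of `transposeHom` (definitional). [cite: Hartshorne1977, II Ex. 5.1 (b)] -/
@[simp]
theorem transposeHom_f (n : ℤ) : (transposeHom X E F).f n = transposeF X E F n := rfl

/-! ## §4 Vector-bundle terms: the transpose is an isomorphism -/

section Iso

variable (hE : ∀ k, IsFiniteLocallyFree (E.X k)) (hF : ∀ k, IsFiniteLocallyFree (F.X k))

variable {X E F} in
/-- The inverse on a summand of `𝓗om•(F•^∨, E•^∨)^n`: `𝓗om((F•^∨)^{-i}, (E•^∨)^q) = 𝓗om((F^{-(-i)})^∨, (E^{-q})^∨) ⟶ 𝓗om•(E•, F•)^n`,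
`χ ↦ (-1)^{i(q+1)} • (T⁻¹ χ)` re-indexed onto the summand `𝓗om(E^{-q}, F^{i})` (`T⁻¹` by `isIso_transposeDual`). [cite: Hartshorne1977, II Ex. 5.1 (b)] -/
def transposeInvSummand (q i n : ℤ) (h : q + i = n) :
    sheafHom ((dualVB X F).X (-i)) ((dualVB X E).X q) ⟶ (homComplex X E F).X n :=
  haveI : IsIso (τ (E := E) (F := F) q i) := isIso_transposeDual (E.X (-q)) (F.X (-(-i))) (hE (-q)) (hF (-(-i)))
  (trSign i q : ℤˣ) • (inv (τ q i) ≫ sheafHomMap (E.X (-q)) (F.XIsoOfEq (neg_neg i)).hom ≫ ι X E F i q n (by lia))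

/-- The inverse in degree `n`. [cite: Hartshorne1977, II Ex. 5.1 (b)] -/
def transposeInvF (n : ℤ) : (homComplex X (dualVB X F) (dualVB X E)).X n ⟶ (homComplex X E F).X n :=
  HomologicalComplex.mapBifunctorDesc fun q i hqi => transposeInvSummand hE hF q i n (by simp at hqi; lia)

/-- `transposeInvF` on a summand. [cite: Hartshorne1977, II Ex. 5.1 (b)] -/
lemma ι_transposeInvF (q i n : ℤ) (h : q + i = n) :
    ι X (dualVB X F) (dualVB X E) q i n h ≫ transposeInvF X E F hE hF n = transposeInvSummand hE hF q i n h :=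
  HomologicalComplex.ι_mapBifunctorDesc _ q i _

/-- `T_n ≫ T⁻¹_n = 𝟙`. [cite: Hartshorne1977, II Ex. 5.1 (b)] -/
lemma transposeF_transposeInvF (n : ℤ) : transposeF X E F n ≫ transposeInvF X E F hE hF n = 𝟙 _ := by
  refine HomologicalComplex.mapBifunctor.hom_ext fun q i hqi => ?_
  have h : q + i = n := by simp at hqi; lia
  change ι X E F q i n h ≫ _ = ι X E F q i n h ≫ _
  haveI : IsIso (τ (E := E) (F := F) i q) := isIso_transposeDual (E.X (-i)) (F.X (-(-q))) (hE (-i)) (hF (-(-q)))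
  rw [reassoc_of% (ι_transposeF X E F q i n h), Category.comp_id, transposeSummand, Linear.units_smul_comp, Category.assoc, Category.assoc,
    ι_transposeInvF, transposeInvSummand, Linear.comp_units_smul, Linear.comp_units_smul, smul_smul, IsIso.hom_inv_id_assoc,
    reassoc_of% (κ_comp_map_hom X E F i q), Int.units_mul_self, one_smul]

/-- `T⁻¹_n ≫ T_n = 𝟙`. [cite: Hartshorne1977, II Ex. 5.1 (b)] -/
lemma transposeInvF_transposeF (n : ℤ) : transposeInvF X E F hE hF n ≫ transposeF X E F n = 𝟙 _ := by
  refine HomologicalComplex.mapBifunctor.hom_ext fun q i hqi => ?_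
  have h : q + i = n := by simp at hqi; lia
  change ι X (dualVB X F) (dualVB X E) q i n h ≫ _ = ι X (dualVB X F) (dualVB X E) q i n h ≫ _
  haveI : IsIso (τ (E := E) (F := F) q i) := isIso_transposeDual (E.X (-q)) (F.X (-(-i))) (hE (-q)) (hF (-(-i)))
  rw [reassoc_of% (ι_transposeInvF X E F hE hF q i n h), Category.comp_id, transposeInvSummand, Linear.units_smul_comp, Category.assoc,
    Category.assoc, ι_transposeF, transposeSummand, Linear.comp_units_smul, Linear.comp_units_smul, smul_smul,
    reassoc_of% (map_hom_comp_κ X E F q i), IsIso.inv_hom_id_assoc, Int.units_mul_self, one_smul]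

/-- Degreewise isomorphism `𝓗om•(E•, F•)^n ≅ 𝓗om•(F•^∨, E•^∨)^n`. [cite: Hartshorne1977, II Ex. 5.1 (b)] -/
def transposeXIso (n : ℤ) : (homComplex X E F).X n ≅ (homComplex X (dualVB X F) (dualVB X E)).X n where
  hom := transposeF X E F n
  inv := transposeInvF X E F hE hF n
  hom_inv_id := transposeF_transposeInvF X E F hE hF n
  inv_hom_id := transposeInvF_transposeF X E F hE hF n

/-- **THE TRANSPOSE CHAIN ISOMORPHISM `𝓗om•(E•, F•) ≅ 𝓗om•(F•^∨, E•^∨)`** for cochain complexes `E•`, `F•` with finite locally free terms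
(`F•^∨ = dualVB X F`, the `𝒪_X`-dual complex `m ↦ (F^{-m})^∨`, `(-1)^{m+1}(d_F)^∨`): summand by summand the signed transpose
`ψ ↦ (-1)^{q(i+1)} ψ^∨` (Hartshorne II Ex. 5.1: `𝓗om(A, B) ≅ A^∨ ⊗ B ≅ 𝓗om(B^∨, A^∨)`). [cite: Hartshorne1977, II Ex. 5.1 (b)]
[cite: StacksProject, More on Algebra, Section «Hom complexes»] -/
def transposeIso : homComplex X E F ≅ homComplex X (dualVB X F) (dualVB X E) :=
  HomologicalComplex.Hom.isoOfComponents (fun n => transposeXIso X E F hE hF n) fun n n' _ => (transposeHom X E F).comm n n'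

/-- The transpose chain isomorphism is the transpose chain map (definitional). [cite: Hartshorne1977, II Ex. 5.1 (b)] -/
@[simp]
theorem transposeIso_hom : (transposeIso X E F hE hF).hom = transposeHom X E F := rfl

end Iso

end HomComplex

end Literature.AlgebraicGeometry.HodgeTheory

end
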